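import Summits.BirchSwinnertonDyer.BirchSwinnertonDyer.Theorems.SylvesterTwoHeegnerIndexCMHalfTowerInvolution
import Summits.BirchSwinnertonDyer.BirchSwinnertonDyer.Theorems.SylvesterTwoHeegnerIndexCMDataRationality
import Literature.NumberTheory.EllipticCurves.RingClassFieldCubeRoots
import HarnessLib

/-!
# (S10d) of leaf (L1) at `p ≡ 7 (mod 9)`, crux `UpperOffV0HSYPlus` (stmt-BirchSwinnertonDyer-19804): THE (W2-b) DISPLAY IS
# NOT STRONGER THAN THE OLD ONE — `hTF′ → (hW2b₁ ∧ hW2b)`; together with #S10c (`hW2b₁ → hW2b → hTF′`) the two displays of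
# the tower fixing are EQUIVALENT modulo tree CFT

Robustness certificate for the planner's vacuity/strength pass (D440) and for the node wording of ASK #2 (ρ3).  #S10c part 2
(p689963) replaced the `∃`-form `hTF′` («there is an involution `φ_n` in the decomposition group at `w ∣ 3`, lifting `s`, fixing
`y_n`») by the `∀`-form `hW2b₁ ∧ hW2b` («EVERY element of `Γ_{K_v}` acting on the embedded ring class field as an involution fixes
the CM point»).  This file proves the converse implication, so nothing was strengthened: a subgroup of the abelian
`Gal(K[9pn]/K)` of order dividing `18` has AT MOST ONE involution (§1, a quotient-by-`⟨φ⟩` count), the image of `Γ_{K_v}` is such a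
subgroup (#S10a `exists_decompositionBound_three`, part 1 `…_of_dvd`; cf. k-ty1 #23 p687159
`JZero.exists_oddIndex_subgroup_sylvesterTower` for the Literature-side form of the local dictionary), and `hTF′` puts ONE involution
`≠ 1` fixing the point into it (at the bottom via the level `n = 1` instance of its own level clause).

* §1 `eq_one_or_eq_of_mem_of_sq_eq_one` — `ψ, φ ∈ D ≤ Gal(K[m]/K)`, `#D ∣ 18`, `φ ≠ 1`, `φ² = ψ² = 1` ⟹ `ψ ∈ {1, φ}`;
* §2 `involutionFixing_bottom_of_decompFixing (Dt) : hTF′ → hW2b₁`;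
* §3 `involutionFixing_level_of_decompFixing (Dt) : hTF′ → hW2b`.

HONEST LABEL: theorems only; implications between DISPLAYED hypotheses (no new facts); nothing asserted on 19804; no stub closed;
X12.CMAtTwo NOT proved; BSD is not proved by any of this, for any curve.  `--supports stmt-BirchSwinnertonDyer-19804 --as helper`.
-/

set_option linter.dupNamespace false
set_option autoImplicit false

noncomputable section

open scoped Classical Pointwise

namespace Summit.BirchSwinnertonDyer.BirchSwinnertonDyer.Theorems.SylvesterTwoCMHalf

open WeierstrassCurve Field NumberField IsDedekindDomain IsDedekindDomain.HeightOneSpectrum Finset Module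
open Literature.NumberTheory.EllipticCurves Literature.NumberTheory.GaloisRepresentations
  Literature.NumberTheory.EllipticCurves.ModularForms
  Literature.NumberTheory.EllipticCurves.HuShuYin2019
  Literature.NumberTheory.EllipticCurves.KolyvaginCocycle
  Literature.NumberTheory.EllipticCurves.RingClassField
  Summit.BirchSwinnertonDyer.BirchSwinnertonDyer.Theorems
  Summit.BirchSwinnertonDyer.BirchSwinnertonDyer.Theorems.SylvesterTwoCMData
  Summit.BirchSwinnertonDyer.BirchSwinnertonDyer.Theorems.SylvesterTwoCMFlip
  Summit.BirchSwinnertonDyer.Rank1Residual.X11b Summit.BirchSwinnertonDyer.Rank1Residual.X11b.RingClassTower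

variable {K : Type} [Field K] [NumberField K]

/-! ## §1 A subgroup of `Gal(K[m]/K)` of order dividing `18` has at most one involution -/

/-- **At most one involution.**  In the abelian group `Gal(K[m]/K)` (tree `isAbelianGalois_ringClassField`), if `D` is a subgroup
with `#D ∣ 18` and `φ ∈ D` is an involution `≠ 1`, then every `ψ ∈ D` with `ψ² = 1` is `1` or `φ`: otherwise `ψ` has order `2` in
`D/⟨φ⟩`, a group of order `#D/2 ∣ 9`. [cite: Cox2013, §9.A (pp. 180–181: K[m]/K abelian)] [cite: GrossLMS1991, §3] -/
theorem eq_one_or_eq_of_mem_of_sq_eq_one (hK : IsImaginaryQuadratic K) (ι : K →+* ℂ) {m : ℕ} (hm0 : m ≠ 0)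
    {D : Subgroup (ringClassField K ι m ≃ₐ[K] ringClassField K ι m)} (hD : Nat.card D ∣ 18)
    {φ ψ : ringClassField K ι m ≃ₐ[K] ringClassField K ι m} (hφD : φ ∈ D) (hψD : ψ ∈ D) (hφ1 : φ ≠ 1)
    (hφ2 : φ * φ = 1) (hψ2 : ψ * ψ = 1) : ψ = 1 ∨ ψ = φ := by
  haveI := isAbelianGalois_ringClassField hK ι hm0
  haveI : Fact (Nat.Prime 2) := ⟨Nat.prime_two⟩
  rcases eq_or_ne ψ 1 with hψ1 | hψ1
  · exact Or.inl hψ1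
  rcases eq_or_ne ψ φ with hψφ | hψφ
  · exact Or.inr hψφ
  exfalso
  set A := Subgroup.zpowers φ with hAdef
  have hA2 : Nat.card A = 2 := by
    rw [hAdef, Nat.card_zpowers]; exact orderOf_eq_prime (by rw [pow_two]; exact hφ2) hφ1
  have hAD : A ≤ D := by rw [hAdef, Subgroup.zpowers_le]; exact hφD
  have hψA : ψ ∉ A := by
    intro hψ
    obtain ⟨k, hk⟩ := Subgroup.mem_zpowers_iff.mp hψ
    rcases Int.even_or_odd k with ⟨j, rfl⟩ | ⟨j, rfl⟩
    · apply hψ1; rw [← hk, ← two_mul, zpow_mul, zpow_two, hφ2, one_zpow]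
    · apply hψφ; rw [← hk, zpow_add, zpow_mul, zpow_two, hφ2, one_zpow, one_mul, zpow_one]
  -- pass to the quotient by `A = ⟨φ⟩`
  set π : (ringClassField K ι m ≃ₐ[K] ringClassField K ι m) →* _ := QuotientGroup.mk' A with hπdef
  have hπψ1 : π ψ ≠ 1 := fun h1 ↦ hψA (by rwa [hπdef, QuotientGroup.mk'_apply, QuotientGroup.eq_one_iff] at h1)
  have hπψ2 : π ψ ^ 2 = 1 := by rw [pow_two, ← map_mul, hψ2, map_one]
  have hord : orderOf (π ψ) = 2 := orderOf_eq_prime hπψ2 hπψ1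
  have hmem : π ψ ∈ D.map π := Subgroup.mem_map_of_mem _ hψD
  have hrel : Nat.card A * A.relIndex D = Nat.card D := by
    rw [← Subgroup.relIndex_bot_left, ← Subgroup.relIndex_bot_left]
    exact Subgroup.relIndex_mul_relIndex ⊥ A D bot_le hAD
  have hmapcard : Nat.card (D.map π) = A.relIndex D := by
    rw [← Subgroup.relIndex_ker D π, hπdef, QuotientGroup.ker_mk']
  have h2dvd : 2 ∣ A.relIndex D := by
    rw [← hmapcard, ← hord]; exact Subgroup.orderOf_dvd_natCard _ hmem
  have h9 : A.relIndex D ∣ 9 := by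
    have h18 : Nat.card A * A.relIndex D ∣ 2 * 9 := by rw [hrel]; exact hD
    rw [hA2] at h18
    exact Nat.dvd_of_mul_dvd_mul_left (by norm_num) h18
  have h29 : (2 : ℕ) ∣ 9 := h2dvd.trans h9
  omega

/-! ## §2 The bottom clause: `hTF′ → hW2b₁` -/

set_option maxHeartbeats 1600000 in
/-- **`hTF′ → hW2b₁`.**  Given the `∃`-form tower fixing `hTF′`, every `τ ∈ Γ_{K_v}` (`v ∋ 3`) acting on `e(K[9p])` as an
involution `s′` fixes `y₁`: `hTF′` supplies an involution `s ≠ 1` fixing `y₁`, realised in the image `D′` of `Γ_{K_v}` by the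
level-`1` instance of its own level clause; `s′ ∈ D′`; `#D′ ∣ 18` (part 1); so `s′ ∈ {1, s}` (§1).
[cite: NeukirchANT1999, Ch. II §9 Prop. (9.6)] [cite: HuShuYin2019, §2.2 Prop. 2.4, §4.1 p. 10] [cite: GrossLMS1991, §3] -/
theorem involutionFixing_bottom_of_decompFixing
    (Dt : ModularParametrizationData (⟨0, 0, 1, 0, -1⟩ : WeierstrassCurve ℚ) 243)
    (hTF' : ∀ (p : ℕ), p.Prime → p % 9 = 7 → ∀ (K : Type) [Field K] [NumberField K] (ω : K), ω ^ 2 + ω + 1 = 0 →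
      Module.finrank ℚ K = 2 → ∀ (ι : K →+* ℂ) (c₃ cp : ringClassField K ι (9 * p)), c₃ ^ 3 = 3 →
      cp ^ 3 = (p : ringClassField K ι (9 * p)) →
      ∀ (y₁ : ((⟨0, 0, 1, 0, -1⟩ : WeierstrassCurve ℚ).baseChange (ringClassField K ι (9 * p))).toAffine.Point),
        Affine.Point.map (W' := (⟨0, 0, 1, 0, -1⟩ : WeierstrassCurve ℚ)) (ringClassField K ι (9 * p)).subtype.toRatAlgHom y₁ =
          Dt.φ (heegnerTau (81 * ((p : ℤ) ^ 2 + 4 * p + 16), -(9 * (4 * (p : ℤ) ^ 2 + 17 * p + 72)), 4 * (p : ℤ) ^ 2 + 18 * p + 81)) →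
      ∃ s : ringClassField K ι (9 * p) ≃ₐ[K] ringClassField K ι (9 * p), s ≠ 1 ∧ s * s = 1 ∧ s c₃ = c₃ ∧ s cp = cp ∧
        pointGalHom (⟨0, 0, 1, 0, -1⟩ : WeierstrassCurve ℚ) (ringClassField K ι (9 * p)) (s.restrictScalars ℚ) y₁ = y₁ ∧
        ∀ (n : ℕ), n ≠ 0 → (∀ q ∈ n.primeFactors, q % 3 = 2) →
          ∀ (hle : ringClassField K ι (9 * p) ≤ ringClassField K ι (9 * p * n))
            (e : ringClassField K ι (9 * p * n) →+* AlgebraicClosure K),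
            (∀ k : K, e (algebraMap K (ringClassField K ι (9 * p * n)) k) = algebraMap K (AlgebraicClosure K) k) →
          ∀ (y : ((⟨0, 0, 1, 0, -1⟩ : WeierstrassCurve ℚ).baseChange (ringClassField K ι (9 * p * n))).toAffine.Point),
            Affine.Point.map (W' := (⟨0, 0, 1, 0, -1⟩ : WeierstrassCurve ℚ)) (ringClassField K ι (9 * p * n)).subtype.toRatAlgHom y =
              Dt.φ (heegnerTau ((n : ℤ) ^ 2 * (81 * ((p : ℤ) ^ 2 + 4 * p + 16)),
                (n : ℤ) * (-(9 * (4 * (p : ℤ) ^ 2 + 17 * p + 72))), 4 * (p : ℤ) ^ 2 + 18 * p + 81)) →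
          ∃ φ : ringClassField K ι (9 * p * n) ≃ₐ[K] ringClassField K ι (9 * p * n),
            (∀ x : ringClassField K ι (9 * p), φ (RingClassField.inclusion ι hle x) = RingClassField.inclusion ι hle (s x)) ∧
            pointGalHom (⟨0, 0, 1, 0, -1⟩ : WeierstrassCurve ℚ) (ringClassField K ι (9 * p * n)) (φ.restrictScalars ℚ) y = y ∧
            φ * φ = 1 ∧
            ∀ (v : HeightOneSpectrum (𝓞 K)), ((3 : ℕ) : 𝓞 K) ∈ v.asIdeal →
              ∃ τ : absoluteGaloisGroup (v.adicCompletion K),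
                ∀ x : ringClassField K ι (9 * p * n), (show AlgebraicClosure K ≃ₐ[K] AlgebraicClosure K from
                  resGal (K := K) (v.adicCompletion K) τ) (e x) = e (φ x)) :
    ∀ (p : ℕ), p.Prime → p % 9 = 7 → ∀ (K : Type) [Field K] [NumberField K] (ω : K), ω ^ 2 + ω + 1 = 0 →
      Module.finrank ℚ K = 2 → ∀ (ι : K →+* ℂ) (v : HeightOneSpectrum (𝓞 K)), ((3 : ℕ) : 𝓞 K) ∈ v.asIdeal →
      ∀ (e : ringClassField K ι (9 * p) →+* AlgebraicClosure K),
        (∀ k : K, e (algebraMap K (ringClassField K ι (9 * p)) k) = algebraMap K (AlgebraicClosure K) k) →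
      ∀ (y₁ : ((⟨0, 0, 1, 0, -1⟩ : WeierstrassCurve ℚ).baseChange (ringClassField K ι (9 * p))).toAffine.Point),
        Affine.Point.map (W' := (⟨0, 0, 1, 0, -1⟩ : WeierstrassCurve ℚ)) (ringClassField K ι (9 * p)).subtype.toRatAlgHom y₁ =
          Dt.φ (heegnerTau (81 * ((p : ℤ) ^ 2 + 4 * p + 16), -(9 * (4 * (p : ℤ) ^ 2 + 17 * p + 72)), 4 * (p : ℤ) ^ 2 + 18 * p + 81)) →
      ∀ (τ : absoluteGaloisGroup (v.adicCompletion K)) (s : ringClassField K ι (9 * p) ≃ₐ[K] ringClassField K ι (9 * p)),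
        (∀ x : ringClassField K ι (9 * p), (show AlgebraicClosure K ≃ₐ[K] AlgebraicClosure K from
          resGal (K := K) (v.adicCompletion K) τ) (e x) = e (s x)) → s * s = 1 →
        pointGalHom (⟨0, 0, 1, 0, -1⟩ : WeierstrassCurve ℚ) (ringClassField K ι (9 * p)) (s.restrictScalars ℚ) y₁ = y₁ := by
  intro p hp hp7 K _ _ ω hω h2 ι v hv e₀ he₀ y₁ hy₁ τ s' hacts hs'2
  have hK := JZero.isImaginaryQuadratic_of_sq_add_self_add_one hω h2
  have hp3 : p % 3 = 1 := by omega
  have hp0 : p ≠ 0 := hp.ne_zero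
  have hp3' : ¬ 3 ∣ p := fun h ↦ by have := Nat.mod_eq_zero_of_dvd h; omega
  have h9p0 : 9 * p ≠ 0 := mul_ne_zero (by norm_num) hp0
  have h9p10 : 9 * p * 1 ≠ 0 := by rw [mul_one]; exact h9p0
  haveI := (finiteDimensional_and_isGalois_ringClassField hK ι h9p0).1
  haveI := (finiteDimensional_and_isGalois_ringClassField hK ι h9p0).2
  -- ### cube roots `∛3, ∛p ∈ K[9p]` (to instantiate `hTF′`)
  obtain ⟨r₃, hr₃⟩ := IsAlgClosed.exists_pow_nat_eq (3 : ℂ) (by norm_num : 0 < 3)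
  obtain ⟨rp, hrp⟩ := IsAlgClosed.exists_pow_nat_eq (p : ℂ) (by norm_num : 0 < 3)
  have hrp_mem : rp ∈ ringClassField K ι (9 * p) := by
    have h := cubeRoot_mem_ringClassField_nine_mul hω h2 ι hp0 one_ne_zero rp hrp
    rwa [mul_one] at h
  let c₃ : ringClassField K ι (9 * p) := ⟨r₃, cubeRoot_three_mem_ringClassField hω h2 ι hp0 r₃ hr₃⟩
  let cp : ringClassField K ι (9 * p) := ⟨rp, hrp_mem⟩
  have hc₃ : c₃ ^ 3 = 3 := by apply Subtype.ext; push_cast; exact hr₃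
  have hcp : cp ^ 3 = (p : ringClassField K ι (9 * p)) := by apply Subtype.ext; push_cast; exact hrp
  obtain ⟨s, hs1, hs2, -, -, hsy, hn⟩ := hTF' p hp hp7 K ω hω h2 ι c₃ cp hc₃ hcp y₁ hy₁
  -- ### the level-`1` instance of the level clause: `s` is realised in the image of `Γ_{K_v}`
  have hle : ringClassField K ι (9 * p) ≤ ringClassField K ι (9 * p * 1) :=
    ringClassField_mono hK ι (Dvd.intro 1 rfl) h9p10
  have hge : ringClassField K ι (9 * p * 1) ≤ ringClassField K ι (9 * p) :=
    ringClassField_mono hK ι (Dvd.intro 1 (by ring)) h9p0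
  set e₁ : ringClassField K ι (9 * p * 1) →+* AlgebraicClosure K := e₀.comp (RingClassField.inclusion ι hge) with he₁def
  have he₁ : ∀ k : K, e₁ (algebraMap K (ringClassField K ι (9 * p * 1)) k) = algebraMap K (AlgebraicClosure K) k := fun k ↦ by
    show e₀ (RingClassField.inclusion ι hge (algebraMap K (ringClassField K ι (9 * p * 1)) k)) = _
    rw [(RingClassField.inclusion ι hge).commutes, he₀]
  obtain ⟨y, hy⟩ := exists_map_eq_phi_sylvesterTau_of_sq_add_self_add_one hω h2 ι Dt hp3 one_ne_zero (n := 1)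
    (fun q hq ↦ by simp [Nat.primeFactors_one] at hq)
  obtain ⟨φ, hφs, -, -, hloc⟩ := hn 1 one_ne_zero (fun q hq ↦ by simp [Nat.primeFactors_one] at hq) hle e₁ he₁ y hy
  obtain ⟨τ₀, hτ₀⟩ := hloc v hv
  have hii : ∀ x : ringClassField K ι (9 * p),
      RingClassField.inclusion ι hge (RingClassField.inclusion ι hle x) = x := fun x ↦
    Subtype.ext (by rw [RingClassField.coe_inclusion, RingClassField.coe_inclusion])
  have hsact : ∀ x : ringClassField K ι (9 * p), (show AlgebraicClosure K ≃ₐ[K] AlgebraicClosure K from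
      resGal (K := K) (v.adicCompletion K) τ₀) (e₀ x) = e₀ (s x) := by
    intro x
    have h1 : e₀ x = e₁ (RingClassField.inclusion ι hle x) := by
      show e₀ x = e₀ (RingClassField.inclusion ι hge (RingClassField.inclusion ι hle x)); rw [hii]
    rw [h1, hτ₀, hφs]
    show e₀ (RingClassField.inclusion ι hge (RingClassField.inclusion ι hle (s x))) = _
    rw [hii]
  -- ### both `s` and `s′` lie in the image `D′ ≤ P`, `#P ∣ 18`; so `s′ ∈ {1, s}`
  obtain ⟨r₀, hr₀, hr₀surj, -⟩ := exists_restrictHom hK ι h9p0 e₀ he₀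
  obtain ⟨P, hP, hPmem⟩ := exists_decompositionBound_three_of_dvd hω h2 ι hp hp3 hp3' (dvd_refl p) v hv e₀ he₀ r₀ hr₀ hr₀surj
  have hsr : r₀ (resGal (K := K) (v.adicCompletion K) τ₀) = s :=
    AlgEquiv.ext fun x ↦ e₀.injective (by rw [← hr₀, hsact])
  have hs'r : r₀ (resGal (K := K) (v.adicCompletion K) τ) = s' :=
    AlgEquiv.ext fun x ↦ e₀.injective (by rw [← hr₀, hacts])
  have hsP : s ∈ P := hsr ▸ hPmem τ₀
  have hs'P : s' ∈ P := hs'r ▸ hPmem τ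
  rcases eq_one_or_eq_of_mem_of_sq_eq_one hK ι h9p0 hP hsP hs'P hs1 hs2 hs'2 with h | h
  · rw [h, show ((1 : ringClassField K ι (9 * p) ≃ₐ[K] ringClassField K ι (9 * p)).restrictScalars ℚ) = 1 from
      AlgEquiv.ext fun _ ↦ rfl, map_one]
    rfl
  · rw [h]; exact hsy

/-! ## §3 The level clause: `hTF′ → hW2b` -/

set_option maxHeartbeats 1600000 in
/-- **`hTF′ → hW2b`.**  At each Kolyvagin level `n`: `hTF′` supplies an involution `φ` fixing `y_n`, realised in the image `D′` of
`Γ_{K_v}`, with `φ ≠ 1` (it restricts to `s ≠ 1`); any `ψ` realised by some `τ ∈ Γ_{K_v}` with `ψ² = 1` lies in `D′`, `#D′ ∣ 18`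
(#S10a), hence `ψ ∈ {1, φ}` (§1) fixes `y_n`. [cite: NeukirchANT1999, Ch. II §9 Prop. (9.6)] [cite: HuShuYin2019, §2.2 Prop. 2.4, §4.1]
[cite: GrossLMS1991, §3] -/
theorem involutionFixing_level_of_decompFixing
    (Dt : ModularParametrizationData (⟨0, 0, 1, 0, -1⟩ : WeierstrassCurve ℚ) 243)
    (hTF' : ∀ (p : ℕ), p.Prime → p % 9 = 7 → ∀ (K : Type) [Field K] [NumberField K] (ω : K), ω ^ 2 + ω + 1 = 0 →
      Module.finrank ℚ K = 2 → ∀ (ι : K →+* ℂ) (c₃ cp : ringClassField K ι (9 * p)), c₃ ^ 3 = 3 →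
      cp ^ 3 = (p : ringClassField K ι (9 * p)) →
      ∀ (y₁ : ((⟨0, 0, 1, 0, -1⟩ : WeierstrassCurve ℚ).baseChange (ringClassField K ι (9 * p))).toAffine.Point),
        Affine.Point.map (W' := (⟨0, 0, 1, 0, -1⟩ : WeierstrassCurve ℚ)) (ringClassField K ι (9 * p)).subtype.toRatAlgHom y₁ =
          Dt.φ (heegnerTau (81 * ((p : ℤ) ^ 2 + 4 * p + 16), -(9 * (4 * (p : ℤ) ^ 2 + 17 * p + 72)), 4 * (p : ℤ) ^ 2 + 18 * p + 81)) →
      ∃ s : ringClassField K ι (9 * p) ≃ₐ[K] ringClassField K ι (9 * p), s ≠ 1 ∧ s * s = 1 ∧ s c₃ = c₃ ∧ s cp = cp ∧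
        pointGalHom (⟨0, 0, 1, 0, -1⟩ : WeierstrassCurve ℚ) (ringClassField K ι (9 * p)) (s.restrictScalars ℚ) y₁ = y₁ ∧
        ∀ (n : ℕ), n ≠ 0 → (∀ q ∈ n.primeFactors, q % 3 = 2) →
          ∀ (hle : ringClassField K ι (9 * p) ≤ ringClassField K ι (9 * p * n))
            (e : ringClassField K ι (9 * p * n) →+* AlgebraicClosure K),
            (∀ k : K, e (algebraMap K (ringClassField K ι (9 * p * n)) k) = algebraMap K (AlgebraicClosure K) k) →
          ∀ (y : ((⟨0, 0, 1, 0, -1⟩ : WeierstrassCurve ℚ).baseChange (ringClassField K ι (9 * p * n))).toAffine.Point),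
            Affine.Point.map (W' := (⟨0, 0, 1, 0, -1⟩ : WeierstrassCurve ℚ)) (ringClassField K ι (9 * p * n)).subtype.toRatAlgHom y =
              Dt.φ (heegnerTau ((n : ℤ) ^ 2 * (81 * ((p : ℤ) ^ 2 + 4 * p + 16)),
                (n : ℤ) * (-(9 * (4 * (p : ℤ) ^ 2 + 17 * p + 72))), 4 * (p : ℤ) ^ 2 + 18 * p + 81)) →
          ∃ φ : ringClassField K ι (9 * p * n) ≃ₐ[K] ringClassField K ι (9 * p * n),
            (∀ x : ringClassField K ι (9 * p), φ (RingClassField.inclusion ι hle x) = RingClassField.inclusion ι hle (s x)) ∧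
            pointGalHom (⟨0, 0, 1, 0, -1⟩ : WeierstrassCurve ℚ) (ringClassField K ι (9 * p * n)) (φ.restrictScalars ℚ) y = y ∧
            φ * φ = 1 ∧
            ∀ (v : HeightOneSpectrum (𝓞 K)), ((3 : ℕ) : 𝓞 K) ∈ v.asIdeal →
              ∃ τ : absoluteGaloisGroup (v.adicCompletion K),
                ∀ x : ringClassField K ι (9 * p * n), (show AlgebraicClosure K ≃ₐ[K] AlgebraicClosure K from
                  resGal (K := K) (v.adicCompletion K) τ) (e x) = e (φ x)) :
    ∀ (p : ℕ), p.Prime → p % 9 = 7 → ∀ (K : Type) [Field K] [NumberField K] (ω : K), ω ^ 2 + ω + 1 = 0 →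
      Module.finrank ℚ K = 2 → ∀ (ι : K →+* ℂ) (v : HeightOneSpectrum (𝓞 K)), ((3 : ℕ) : 𝓞 K) ∈ v.asIdeal →
      ∀ (n : ℕ), n ≠ 0 → (∀ q ∈ n.primeFactors, q % 3 = 2) →
      ∀ (e : ringClassField K ι (9 * p * n) →+* AlgebraicClosure K),
        (∀ k : K, e (algebraMap K (ringClassField K ι (9 * p * n)) k) = algebraMap K (AlgebraicClosure K) k) →
      ∀ (y : ((⟨0, 0, 1, 0, -1⟩ : WeierstrassCurve ℚ).baseChange (ringClassField K ι (9 * p * n))).toAffine.Point),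
        Affine.Point.map (W' := (⟨0, 0, 1, 0, -1⟩ : WeierstrassCurve ℚ)) (ringClassField K ι (9 * p * n)).subtype.toRatAlgHom y =
          Dt.φ (heegnerTau ((n : ℤ) ^ 2 * (81 * ((p : ℤ) ^ 2 + 4 * p + 16)),
            (n : ℤ) * (-(9 * (4 * (p : ℤ) ^ 2 + 17 * p + 72))), 4 * (p : ℤ) ^ 2 + 18 * p + 81)) →
      ∀ (τ : absoluteGaloisGroup (v.adicCompletion K))
        (φ : ringClassField K ι (9 * p * n) ≃ₐ[K] ringClassField K ι (9 * p * n)),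
        (∀ x : ringClassField K ι (9 * p * n), (show AlgebraicClosure K ≃ₐ[K] AlgebraicClosure K from
          resGal (K := K) (v.adicCompletion K) τ) (e x) = e (φ x)) → φ * φ = 1 →
        pointGalHom (⟨0, 0, 1, 0, -1⟩ : WeierstrassCurve ℚ) (ringClassField K ι (9 * p * n)) (φ.restrictScalars ℚ) y = y := by
  intro p hp hp7 K _ _ ω hω h2 ι v hv n hn0 hq e he y hy τ ψ hacts hψ2
  have hK := JZero.isImaginaryQuadratic_of_sq_add_self_add_one hω h2
  have hp3 : p % 3 = 1 := by omega
  have hp0 : p ≠ 0 := hp.ne_zero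
  have h9p0 : 9 * p ≠ 0 := mul_ne_zero (by norm_num) hp0
  have h9pn0 : 9 * p * n ≠ 0 := mul_ne_zero h9p0 hn0
  have hn3 : ¬ 3 ∣ n := fun h3 ↦ by
    have := hq 3 (Nat.mem_primeFactors.mpr ⟨Nat.prime_three, h3, hn0⟩)
    omega
  haveI := (finiteDimensional_and_isGalois_ringClassField hK ι h9p0).1
  haveI := (finiteDimensional_and_isGalois_ringClassField hK ι h9p0).2
  haveI := (finiteDimensional_and_isGalois_ringClassField hK ι h9pn0).1
  haveI := (finiteDimensional_and_isGalois_ringClassField hK ι h9pn0).2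
  -- ### bottom data to instantiate `hTF′`: `∛3, ∛p, y₁`
  obtain ⟨r₃, hr₃⟩ := IsAlgClosed.exists_pow_nat_eq (3 : ℂ) (by norm_num : 0 < 3)
  obtain ⟨rp, hrp⟩ := IsAlgClosed.exists_pow_nat_eq (p : ℂ) (by norm_num : 0 < 3)
  have hrp_mem : rp ∈ ringClassField K ι (9 * p) := by
    have h := cubeRoot_mem_ringClassField_nine_mul hω h2 ι hp0 one_ne_zero rp hrp
    rwa [mul_one] at h
  let c₃ : ringClassField K ι (9 * p) := ⟨r₃, cubeRoot_three_mem_ringClassField hω h2 ι hp0 r₃ hr₃⟩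
  let cp : ringClassField K ι (9 * p) := ⟨rp, hrp_mem⟩
  have hc₃ : c₃ ^ 3 = 3 := by apply Subtype.ext; push_cast; exact hr₃
  have hcp : cp ^ 3 = (p : ringClassField K ι (9 * p)) := by apply Subtype.ext; push_cast; exact hrp
  obtain ⟨y₁, hy₁⟩ := exists_map_eq_phi_sylvesterTau_one_of_sq_add_self_add_one hω h2 ι Dt hp3
  obtain ⟨s, hs1, -, -, -, -, hnn⟩ := hTF' p hp hp7 K ω hω h2 ι c₃ cp hc₃ hcp y₁ hy₁
  have hle : ringClassField K ι (9 * p) ≤ ringClassField K ι (9 * p * n) := ringClassField_nine_mul_le hK ι hp0 hn0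
  obtain ⟨φ, hφs, hφy, hφ2, hloc⟩ := hnn n hn0 hq hle e he y hy
  obtain ⟨τ₀, hτ₀⟩ := hloc v hv
  have hφ1 : φ ≠ 1 := by
    intro h1
    apply hs1
    refine AlgEquiv.ext fun x ↦ (RingClassField.inclusion ι hle).injective ?_
    have hx := hφs x
    rw [h1, AlgEquiv.one_apply] at hx
    rw [AlgEquiv.one_apply]
    exact hx.symm
  -- ### `φ, ψ ∈ D′ ≤ P`, `#P ∣ 18`; so `ψ ∈ {1, φ}`
  obtain ⟨r, hr, hrsurj, -⟩ := exists_restrictHom hK ι h9pn0 e he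
  obtain ⟨P, hP, hPmem⟩ := exists_decompositionBound_three hω h2 ι hp hp3 hn0 hn3 v hv e he r hr hrsurj
  have hφr : r (resGal (K := K) (v.adicCompletion K) τ₀) = φ :=
    AlgEquiv.ext fun x ↦ e.injective (by rw [← hr, hτ₀])
  have hψr : r (resGal (K := K) (v.adicCompletion K) τ) = ψ :=
    AlgEquiv.ext fun x ↦ e.injective (by rw [← hr, hacts])
  have hφP : φ ∈ P := hφr ▸ hPmem τ₀
  have hψP : ψ ∈ P := hψr ▸ hPmem τ
  rcases eq_one_or_eq_of_mem_of_sq_eq_one hK ι h9pn0 hP hφP hψP hφ1 hφ2 hψ2 with h | h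
  · rw [h, show ((1 : ringClassField K ι (9 * p * n) ≃ₐ[K] ringClassField K ι (9 * p * n)).restrictScalars ℚ) = 1 from
      AlgEquiv.ext fun _ ↦ rfl, map_one]
    rfl
  · rw [h]; exact hφy

end Summit.BirchSwinnertonDyer.BirchSwinnertonDyer.Theorems.SylvesterTwoCMHalf

end
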